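import Literature.AnabelianGeometry.EtaleTheta.FrobenioidThetaBiKummerOfModel
import Literature.AnabelianGeometry.EtaleTheta.Discharge.Sec4NonVacuity
import HarnessLib

/-!
# [EtTh] Prop. 4.2 (iii) / Prop. 5.2 (i) phrase `PairIsNthRootOf` ("`(s, s')` constitutes an `M`-th root of a
# right fraction-pair of `f`"): the UNIVERSAL CLOSURE is refuted in the kernel, the instance forms are proved

S. Mochizuki, *The étale theta function and its Frobenioid-theoretic manifestations*, Publ. RIMS **45**
(2009) [MochizukiEtTh2009], Prop. 4.2 (iii) p.314 (PDF p.88) (the data `(A_N, B_N, α, β, f_N, (s'_N, s''_N))`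
of an `N`-th root of a right fraction-pair, `N ≥ 1`), Prop. 5.2 (i) p.324 (PDF p.98) (the phrase), Rmk. 4.3.2
pp.318–319 (PDF pp.92–93) ("`g` is an `M`-th root of `f`").  FACT-LIST row **F-2667** `BiKummerSetting.PairIsNthRootOf`
of the abc-iut cell (status «model-witness», untranched; seat abc-iut-f-118, gen 4, float) and its sibling predicate
`BiKummerSetting.IsNthRootOf` (row F-2668, vocabulary).

PROOF-ONLY companion of abc-iut-L2-t4's merge adapter `FrobenioidThetaBiKummerOfModel.lean` (p412270): no
definition, no named fact, no instance, no `sorry`; nothing there or in `BiKummerRoots.lean` /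
`Discharge/Sec4NonVacuity.lean` is edited or restated.  Both declarations are PREDICATES over the §4 hypothesis
structure `S : BiKummerSetting X T D VD` (abc-iut-L2-t3), a free transport parameter `pullFrac`
("`((α')^birat)^*`"), a free exponent `M : ℕ`, a free unit `f ∈ O^×(A^birat)` and a free pair of arrows
`s, s' : S' → T'`; by definition each begins `∃ (hM : 0 < M), …` (print: `N ∈ ℕ_{≥1}`, §4 p.311 (PDF p.85)).
What is shown:

* **Instance content (every setting, every transport).** `PairIsNthRootOf.pos` / `IsNthRootOf.pos`: the phrase
  forces `0 < M`; `PairIsNthRootOf.of_nthRoot_iso`: the root pair of any genuine `N`-th root (the DATA structure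
  `NthRoot` of Prop. 4.2 (iii)), read through any isomorphisms `ζ_A, ζ_B` of `C`, satisfies the phrase (abc-iut-L2-t4's
  `pairIsNthRootOf_nthRoot` is the case `ζ_A = ζ_B = id`); `isNthRootOf_pullFrac_id_root` / `isNthRootOf_root`:
  the root element `f_N` of a genuine `N`-th root "is an `N`-th root of `f`" (outright for `((id)^birat)^*(f_N)`,
  and for `f_N` itself whenever the transport fixes identities, as the model transport `pullFracModel` does).
* **Closed witnesses.** At the inhabited §4 setting of record `Toy.biKummerSetting` (abc-iut-w5-d071 lineage,
  `Discharge/Sec4NonVacuity.lean`: the canonical model over the perfect toy tempered Frobenioid, `A_⊙ = (∗, 0)`,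
  genuine transport `pullFracModel`) the `1`-st root `Toy.nthRootOne` of the trivial fraction-pair gives
  `Toy.pairIsNthRootOf_nthRootOne` and `Toy.isNthRootOf_nthRootOne` — the predicates are INHABITED at a closed term.
* **Row F-2667: the universal closure is FALSE** — `not_pairIsNthRootOf_zero` (no pair of arrows is a `0`-th root
  of anything, at ANY setting and transport) and the closed form `not_forall_pairIsNthRootOf` (instantiate at
  `Toy.biKummerSetting`, `M = 0`, `f = 1`, `s = s' = id_{A_⊙}`); likewise `not_isNthRootOf_zero`,
  `not_forall_isNthRootOf` for F-2668.

READING.  The refuted closure is a statement about the TYPED PHRASE with its exponent left free (the binder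
`M = 0` lies outside print's `ℕ_{≥1}`), not about [EtTh] Prop. 4.2 (iii) or Prop. 5.2 (i): the row is a schema,
consumed per instance — at genuine roots (`pairIsNthRootOf_nthRoot`, abc-iut-w5-d134's
`exists_nthRoot_pairIsNthRootOf_mul_mkOfModelCanonical`, abc-iut-L2-t4's `thetaPairIsRoot_of…`), never as a
closed `∀`-hypothesis.  Consistency witnesses are toys: consistency ≠ faithfulness.  Typed ≠ proved.  Nothing here
bears on, or takes a side on, [IUTchIII] Cor. 3.12.
-/

namespace Literature.AnabelianGeometry.EtaleTheta

open CategoryTheory Opposite Literature.AlgebraicGeometry.Frobenioids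

universe u₀ v₀ u v w

variable {K : Type u₀} [Field K]

namespace BiKummerSetting

variable {X : SemiGraphs.TemperedArithmeticGroup.{u₀} K} {D₀ : Type u₀} [Category.{v₀} D₀]
  {V : FrdIMonoidStub.{w}} {T : RealifiedDivisorMonoids (D₀ := D₀) V} {D : Type u} [Category.{v} D]
  {VD : FrdICatStub.{u, v, w} D} (S : BiKummerSetting X T D VD)
  (pullFrac : ∀ {A A' : S.C} (_ : A' ⟶ A), S.biratUnits A → S.biratUnits A')

/-! ## Instance content of the phrase (every setting, every transport) -/

/-- "`(s, s')` constitutes an `M`-th root of a right fraction-pair of `f`" forces `M ≥ 1` (print: `N ∈ ℕ_{≥1}`,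
§4 p.311 (PDF p.85); the typed phrase begins `∃ (hM : 0 < M), …`).
[cite: MochizukiEtTh2009, Prop 4.2 (iii) p.314 (PDF p.88)] -/
theorem PairIsNthRootOf.pos {M : ℕ} {A S' T' : S.C} {f : S.biratUnits A} {s s' : S' ⟶ T'}
    (h : S.PairIsNthRootOf pullFrac M f s s') : 0 < M := by
  obtain ⟨hM, -⟩ := h
  exact hM

/-- "`g` is an `M`-th root of `f`" forces `M ≥ 1` (Rmk. 4.3.2 with Prop. 4.2 (iii): roots are indexed by
`N ∈ ℕ_{≥1}`). [cite: MochizukiEtTh2009, Rmk 4.3.2 p.318 (PDF p.92)] -/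
theorem IsNthRootOf.pos {M : ℕ} {A' A : S.C} {g : S.biratUnits A'} {f : S.biratUnits A}
    (h : S.IsNthRootOf pullFrac M g f) : 0 < M := by
  obtain ⟨hM, -⟩ := h
  exact hM

/-- **No pair of arrows is a `0`-th root of a right fraction-pair** — at ANY §4 setting, for ANY transport: the
degenerate exponent `M = 0` of the typed phrase is uninhabited. [cite: MochizukiEtTh2009, Prop 4.2 (iii) p.314 (PDF p.88)] -/
theorem not_pairIsNthRootOf_zero {A S' T' : S.C} (f : S.biratUnits A) (s s' : S' ⟶ T') :
    ¬ S.PairIsNthRootOf pullFrac 0 f s s' :=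
  fun h => Nat.lt_irrefl 0 (PairIsNthRootOf.pos S pullFrac h)

/-- **Nothing is a `0`-th root of `f`** — at ANY §4 setting, for ANY transport.
[cite: MochizukiEtTh2009, Rmk 4.3.2 p.318 (PDF p.92)] -/
theorem not_isNthRootOf_zero {A' A : S.C} (g : S.biratUnits A') (f : S.biratUnits A) :
    ¬ S.IsNthRootOf pullFrac 0 g f :=
  fun h => Nat.lt_irrefl 0 (IsNthRootOf.pos S pullFrac h)

/-- The root pair `(s'_N, s''_N)` of a genuine `N`-th root `R` (the DATA of Prop. 4.2 (iii)), read through ANY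
isomorphisms `ζ_A : A_N ⥲ S'`, `ζ_B : B_N ⥲ T'` of `C`, "constitutes an `N`-th root of a right fraction-pair of
`f`" (Prop. 4.2 (iv): roots are determined exactly up to such isomorphisms; abc-iut-L2-t4's
`pairIsNthRootOf_nthRoot` is `ζ_A = ζ_B = id`). [cite: MochizukiEtTh2009, Prop 4.2 (iii)–(iv) pp.314–315 (PDF pp.88–89)] -/
theorem PairIsNthRootOf.of_nthRoot_iso {A B : S.C} {f : S.biratUnits A} {P : S.FractionPair f B} {N : ℕ+}
    (R : S.NthRoot f P N pullFrac) {S' T' : S.C} (ζA : R.AN ≅ S') (ζB : R.BN ≅ T') :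
    S.PairIsNthRootOf pullFrac (N : ℕ) f (ζA.inv ≫ R.pair.num ≫ ζB.hom) (ζA.inv ≫ R.pair.den ≫ ζB.hom) :=
  ⟨N.pos, B, P, R, ζA, ζB, rfl, rfl⟩

/-- A pair of arrows satisfying the phrase for `M` satisfies it for the POSITIVE exponent `⟨M, _⟩ : ℕ+` read back
in `ℕ` — the `ℕ`/`ℕ_{≥1}` currency exchange used by the `NthRoot` consumers (`N : ℕ+`).
[cite: MochizukiEtTh2009, Prop 4.2 (iii) p.314 (PDF p.88)] -/
theorem PairIsNthRootOf.exists_pnat {M : ℕ} {A S' T' : S.C} {f : S.biratUnits A} {s s' : S' ⟶ T'}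
    (h : S.PairIsNthRootOf pullFrac M f s s') :
    ∃ N : ℕ+, (N : ℕ) = M ∧ ∃ (B : S.C) (P : S.FractionPair f B) (R : S.NthRoot f P N pullFrac)
      (ζA : R.AN ≅ S') (ζB : R.BN ≅ T'),
      ζA.inv ≫ R.pair.num ≫ ζB.hom = s ∧ ζA.inv ≫ R.pair.den ≫ ζB.hom = s' := by
  obtain ⟨hM, B, P, R, ζA, ζB, h₁, h₂⟩ := h
  exact ⟨⟨M, hM⟩, rfl, B, P, R, ζA, ζB, h₁, h₂⟩

/-- The root element `f_N ∈ O^×(A_N^birat)` of a genuine `N`-th root, pulled back along `id_{A_N}`, "is an `N`-th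
root of `f`" (Rmk. 4.3.2; `ζ := id`). [cite: MochizukiEtTh2009, Rmk 4.3.2 p.318 (PDF p.92)] -/
theorem isNthRootOf_pullFrac_id_root {A B : S.C} {f : S.biratUnits A} {P : S.FractionPair f B} {N : ℕ+}
    (R : S.NthRoot f P N pullFrac) :
    S.IsNthRootOf pullFrac (N : ℕ) (pullFrac (𝟙 R.AN) R.root) f :=
  ⟨N.pos, B, P, R, Iso.refl _, rfl⟩

/-- The root element `f_N` of a genuine `N`-th root "is an `N`-th root of `f`", for any transport fixing
identities (`((id)^birat)^* = id`, as the model transport `pullFracModel` does: `pullFracModel_id`).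
[cite: MochizukiEtTh2009, Rmk 4.3.2 p.318 (PDF p.92)] -/
theorem isNthRootOf_root (hid : ∀ (A : S.C) (x : S.biratUnits A), pullFrac (𝟙 A) x = x)
    {A B : S.C} {f : S.biratUnits A} {P : S.FractionPair f B} {N : ℕ+} (R : S.NthRoot f P N pullFrac) :
    S.IsNthRootOf pullFrac (N : ℕ) R.root f :=
  ⟨N.pos, B, P, R, Iso.refl _, by rw [Iso.refl_inv]; exact hid _ _⟩

end BiKummerSetting

/-! ## Closed witnesses at the inhabited §4 setting of record, and the schema verdicts -/

namespace Toy

/-- **F-2667 is INHABITED at a closed term**: at `Toy.biKummerSetting` (canonical model over the perfect toy,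
genuine transport `pullFracModel`) the root pair of the `1`-st root `Toy.nthRootOne` of the trivial fraction-pair
of `f = 1 ∈ O^×(A_⊙^birat)` "constitutes a `1`-st root of a right fraction-pair of `1`".
[cite: MochizukiEtTh2009, Prop 4.2 (iii) p.314 (PDF p.88)] -/
theorem pairIsNthRootOf_nthRootOne :
    biKummerSetting.PairIsNthRootOf
      (fun {A A' : biKummerSetting.C} (φ : A' ⟶ A) => ⇑(temperedFrobenioidQ.pullFracModel φ)) 1
      (1 : biKummerSetting.biratUnits Aodot) fractionPairOne.num fractionPairOne.den :=
  BiKummerSetting.pairIsNthRootOf_nthRoot biKummerSetting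
    (fun {A A' : biKummerSetting.C} (φ : A' ⟶ A) => ⇑(temperedFrobenioidQ.pullFracModel φ)) nthRootOne

/-- **F-2668 is INHABITED at a closed term**: at `Toy.biKummerSetting`, `1 ∈ O^×(A_⊙^birat)` "is a `1`-st root of
`1`" (root element of `Toy.nthRootOne`; `pullFracModel (id) = id` on the unit `1` by `map_one`).
[cite: MochizukiEtTh2009, Rmk 4.3.2 p.318 (PDF p.92)] -/
theorem isNthRootOf_nthRootOne :
    biKummerSetting.IsNthRootOf
      (fun {A A' : biKummerSetting.C} (φ : A' ⟶ A) => ⇑(temperedFrobenioidQ.pullFracModel φ)) 1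
      (1 : biKummerSetting.biratUnits Aodot) (1 : biKummerSetting.biratUnits Aodot) :=
  ⟨Nat.one_pos, Aodot, fractionPairOne, nthRootOne, Iso.refl _, by
    show temperedFrobenioidQ.pullFracModel (Iso.refl Aodot).inv (1 : biKummerSetting.biratUnits Aodot) = 1
    exact map_one _⟩

end Toy

namespace BiKummerSetting

/-- **Row F-2667: the universal closure of the phrase `PairIsNthRootOf` is FALSE** — witness: the inhabited §4
setting `Toy.biKummerSetting` with its genuine transport, exponent `M = 0`, `f = 1 ∈ O^×(A_⊙^birat)`,
`s = s' = id_{A_⊙}` (`not_pairIsNthRootOf_zero`).  The row is a schema over `(M, f, s, s')`, to be consumed per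
instance (`pairIsNthRootOf_nthRoot`, `Toy.pairIsNthRootOf_nthRootOne`), never as a closed `∀`-hypothesis.
[cite: MochizukiEtTh2009, Prop 4.2 (iii) p.314 (PDF p.88)] -/
theorem not_forall_pairIsNthRootOf :
    ¬ ∀ {K : Type} [Field K] {X : SemiGraphs.TemperedArithmeticGroup.{0} K} {D₀ : Type}
        [Category.{0} D₀] {V : FrdIMonoidStub.{0}} {T : RealifiedDivisorMonoids (D₀ := D₀) V}
        {D : Type} [Category.{0} D] {VD : FrdICatStub.{0, 0, 0} D} (S : BiKummerSetting X T D VD)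
        (pullFrac : ∀ {A A' : S.C} (_ : A' ⟶ A), S.biratUnits A → S.biratUnits A')
        (M : ℕ) (A S' T' : S.C) (f : S.biratUnits A) (s s' : S' ⟶ T'),
        S.PairIsNthRootOf pullFrac M f s s' :=
  fun h => not_pairIsNthRootOf_zero Toy.biKummerSetting
    (fun {A A' : Toy.biKummerSetting.C} (φ : A' ⟶ A) => ⇑(Toy.temperedFrobenioidQ.pullFracModel φ))
    (1 : Toy.biKummerSetting.biratUnits Toy.Aodot)
    (𝟙 Toy.Aodot) (𝟙 Toy.Aodot) (h _ _ 0 _ _ _ _ _ _)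

/-- **Row F-2668 (vocabulary): the universal closure of `IsNthRootOf` is FALSE** — same witness, `g = f = 1`,
`M = 0` (`not_isNthRootOf_zero`); inhabited instance: `Toy.isNthRootOf_nthRootOne`.
[cite: MochizukiEtTh2009, Rmk 4.3.2 p.318 (PDF p.92)] -/
theorem not_forall_isNthRootOf :
    ¬ ∀ {K : Type} [Field K] {X : SemiGraphs.TemperedArithmeticGroup.{0} K} {D₀ : Type}
        [Category.{0} D₀] {V : FrdIMonoidStub.{0}} {T : RealifiedDivisorMonoids (D₀ := D₀) V}
        {D : Type} [Category.{0} D] {VD : FrdICatStub.{0, 0, 0} D} (S : BiKummerSetting X T D VD)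
        (pullFrac : ∀ {A A' : S.C} (_ : A' ⟶ A), S.biratUnits A → S.biratUnits A')
        (M : ℕ) (A' A : S.C) (g : S.biratUnits A') (f : S.biratUnits A),
        S.IsNthRootOf pullFrac M g f :=
  fun h => not_isNthRootOf_zero Toy.biKummerSetting
    (fun {A A' : Toy.biKummerSetting.C} (φ : A' ⟶ A) => ⇑(Toy.temperedFrobenioidQ.pullFracModel φ))
    (1 : Toy.biKummerSetting.biratUnits Toy.Aodot)
    (1 : Toy.biKummerSetting.biratUnits Toy.Aodot) (h _ _ 0 _ _ _ _)

/-- **Schema verdict for F-2667 / F-2668 in one line**: both universal closures are refuted AND both phrases are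
inhabited at a closed §4 setting — they are schemata over `(M, f, s, s')` resp. `(M, g, f)`, consumed per instance.
[cite: MochizukiEtTh2009, Prop 4.2 (iii) p.314 (PDF p.88); Rmk 4.3.2 p.318 (PDF p.92)] -/
theorem rows_F2667_F2668_schema_verdict :
    (¬ ∀ {K : Type} [Field K] {X : SemiGraphs.TemperedArithmeticGroup.{0} K} {D₀ : Type}
        [Category.{0} D₀] {V : FrdIMonoidStub.{0}} {T : RealifiedDivisorMonoids (D₀ := D₀) V}
        {D : Type} [Category.{0} D] {VD : FrdICatStub.{0, 0, 0} D} (S : BiKummerSetting X T D VD)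
        (pullFrac : ∀ {A A' : S.C} (_ : A' ⟶ A), S.biratUnits A → S.biratUnits A')
        (M : ℕ) (A S' T' : S.C) (f : S.biratUnits A) (s s' : S' ⟶ T'),
        S.PairIsNthRootOf pullFrac M f s s') ∧
    (¬ ∀ {K : Type} [Field K] {X : SemiGraphs.TemperedArithmeticGroup.{0} K} {D₀ : Type}
        [Category.{0} D₀] {V : FrdIMonoidStub.{0}} {T : RealifiedDivisorMonoids (D₀ := D₀) V}
        {D : Type} [Category.{0} D] {VD : FrdICatStub.{0, 0, 0} D} (S : BiKummerSetting X T D VD)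
        (pullFrac : ∀ {A A' : S.C} (_ : A' ⟶ A), S.biratUnits A → S.biratUnits A')
        (M : ℕ) (A' A : S.C) (g : S.biratUnits A') (f : S.biratUnits A),
        S.IsNthRootOf pullFrac M g f) ∧
    Toy.biKummerSetting.PairIsNthRootOf
      (fun {A A' : Toy.biKummerSetting.C} (φ : A' ⟶ A) => ⇑(Toy.temperedFrobenioidQ.pullFracModel φ)) 1
      (1 : Toy.biKummerSetting.biratUnits Toy.Aodot) Toy.fractionPairOne.num Toy.fractionPairOne.den ∧
    Toy.biKummerSetting.IsNthRootOf
      (fun {A A' : Toy.biKummerSetting.C} (φ : A' ⟶ A) => ⇑(Toy.temperedFrobenioidQ.pullFracModel φ)) 1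
      (1 : Toy.biKummerSetting.biratUnits Toy.Aodot) (1 : Toy.biKummerSetting.biratUnits Toy.Aodot) :=
  ⟨not_forall_pairIsNthRootOf, not_forall_isNthRootOf, Toy.pairIsNthRootOf_nthRootOne,
    Toy.isNthRootOf_nthRootOne⟩

end BiKummerSetting

end Literature.AnabelianGeometry.EtaleTheta
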